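import Mathlib
import Summits.Ventures.PercRepro2.TypedResidual

/-!
# The residual class in degree language (blind cell PercRepro2, p2 g0, 2026-08-25; sub-claim S1,
`proofs/subclaims/S1-REDUCTION.md`)

The typed degree `typedDeg ends F v` = the number of typed edges at `v`. On a fully reduced typed
graph (`Reduced`, TypedResidual.lean):

* `Reduced.typedDeg_unmarked` — every unmarked vertex incident to a typed edge has typed degree
  `≥ 3` (rules (c′) and (a): no typed leaf, no typed degree two);
* `Reduced.typedDeg_b` / `Reduced.typedDeg_o` — `b` (resp. `o`), when it carries no other mark, has
  typed degree `≠ 1` (rule (d′));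
* `Residual.typedDeg_marks` — on `NR` each of `a₁, a₂, o, b` has typed degree `≥ 1`, and `b`, `o`
  (distinct from the other marks) typed degree `≥ 2`;
* `Reduced.simple` — `(V, F)` has no loop and no parallel pair, and no edge `a₁a₂`.

These are the reformulations the residual class is quoted in (LEAD-TYPED-REDUCTION.md §2: «simple,
every unmarked vertex of degree ≥ 3, `b` / `o` of degree ≥ 2»), proved from the fields of `Reduced`.
Own code; standard axioms.
-/

namespace Summit.Ventures.PercRepro2

open UnionCluster

namespace CovForm

namespace TypedRed

section Degree

variable {V : Type*} {E : Type*} [DecidableEq V] [DecidableEq E]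

/-- The typed degree of `v`: the number of typed edges at `v`. -/
def typedDeg (ends : E → Sym2 V) (F : Finset E) (v : V) : ℕ :=
  (F.filter fun e => v ∈ ends e).card

/-- Three distinct typed edges at `v` give typed degree at least three. -/
lemma three_le_typedDeg {ends : E → Sym2 V} {F : Finset E} {v : V} {e₁ e₂ e₃ : E}
    (h₁ : e₁ ∈ F) (h₂ : e₂ ∈ F) (h₃ : e₃ ∈ F) (hv₁ : v ∈ ends e₁) (hv₂ : v ∈ ends e₂)
    (hv₃ : v ∈ ends e₃) (h₁₂ : e₁ ≠ e₂) (h₁₃ : e₁ ≠ e₃) (h₂₃ : e₂ ≠ e₃) :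
    3 ≤ typedDeg ends F v := by
  have hsub : ({e₁, e₂, e₃} : Finset E) ⊆ F.filter fun e => v ∈ ends e := by
    intro e he
    simp only [Finset.mem_insert, Finset.mem_singleton] at he
    rw [Finset.mem_filter]
    rcases he with rfl | rfl | rfl
    · exact ⟨h₁, hv₁⟩
    · exact ⟨h₂, hv₂⟩
    · exact ⟨h₃, hv₃⟩
  have hcard : ({e₁, e₂, e₃} : Finset E).card = 3 := by
    rw [Finset.card_insert_of_notMem, Finset.card_insert_of_notMem, Finset.card_singleton]
    · exact fun h => h₂₃ (Finset.mem_singleton.1 h)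
    · intro h
      rw [Finset.mem_insert, Finset.mem_singleton] at h
      rcases h with h | h
      · exact h₁₂ h
      · exact h₁₃ h
  unfold typedDeg
  rw [← hcard]
  exact Finset.card_le_card hsub

/-- Two distinct typed edges at `v` give typed degree at least two. -/
lemma two_le_typedDeg {ends : E → Sym2 V} {F : Finset E} {v : V} {e₁ e₂ : E}
    (h₁ : e₁ ∈ F) (h₂ : e₂ ∈ F) (hv₁ : v ∈ ends e₁) (hv₂ : v ∈ ends e₂) (h₁₂ : e₁ ≠ e₂) :
    2 ≤ typedDeg ends F v := by
  have hsub : ({e₁, e₂} : Finset E) ⊆ F.filter fun e => v ∈ ends e := by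
    intro e he
    simp only [Finset.mem_insert, Finset.mem_singleton] at he
    rw [Finset.mem_filter]
    rcases he with rfl | rfl
    · exact ⟨h₁, hv₁⟩
    · exact ⟨h₂, hv₂⟩
  have hcard : ({e₁, e₂} : Finset E).card = 2 := by
    rw [Finset.card_insert_of_notMem, Finset.card_singleton]
    exact fun h => h₁₂ (Finset.mem_singleton.1 h)
  unfold typedDeg
  rw [← hcard]
  exact Finset.card_le_card hsub

omit [DecidableEq E] in
/-- One typed edge at `v` gives typed degree at least one. -/
lemma one_le_typedDeg {ends : E → Sym2 V} {F : Finset E} {v : V} {e : E} (he : e ∈ F)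
    (hv : v ∈ ends e) : 1 ≤ typedDeg ends F v := by
  unfold typedDeg
  exact Finset.card_pos.2 ⟨e, Finset.mem_filter.2 ⟨he, hv⟩⟩

omit [DecidableEq V] [DecidableEq E] in
/-- A non-loop typed edge at `v` has a second end different from `v`. -/
lemma exists_other_end {ends : E → Sym2 V} {F : Finset E} (hnl : ∀ f ∈ F, ¬ (ends f).IsDiag)
    {f : E} (hf : f ∈ F) {v : V} (hv : v ∈ ends f) : ∃ u, ends f = s(v, u) ∧ v ≠ u := by
  obtain ⟨u, hu⟩ := Sym2.mem_iff_exists.1 hv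
  refine ⟨u, hu, fun h => hnl f hf ?_⟩
  rw [hu, ← h]
  exact Sym2.mk_isDiag_iff.2 rfl

/-- **Unmarked vertices of a reduced typed graph have typed degree `≥ 3`** (rules (c′) and (a)). -/
theorem Reduced.typedDeg_unmarked {ends : E → Sym2 V} {o a₁ a₂ a₃ b : V} {F : Finset E}
    (h : Reduced ends o a₁ a₂ a₃ b F) {l : V} (hlo : l ≠ o) (hl1 : l ≠ a₁) (hl2 : l ≠ a₂)
    (hl3 : l ≠ a₃) (hlb : l ≠ b) {f : E} (hf : f ∈ F) (hl : l ∈ ends f) :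
    3 ≤ typedDeg ends F l := by
  obtain ⟨u, hfu, hlu⟩ := exists_other_end h.no_loop hf hl
  obtain ⟨e', he'F, he'f, hle'⟩ := h.no_leaf f hf l u hfu hlu hlo hl1 hl2 hl3 hlb
  obtain ⟨v, he'v, hlv⟩ := exists_other_end h.no_loop he'F hle'
  have hfu' : ends f = s(u, l) := by rw [hfu, Sym2.eq_swap]
  obtain ⟨e'', he''F, he''f, he''e', hle''⟩ :=
    h.no_series f hf e' he'F he'f.symm u l v hfu' he'v hlu hlv hlo hl1 hl2 hl3 hlb
  exact three_le_typedDeg hf he'F he''F hl hle' hle'' he'f.symm he''f.symm he''e'.symm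

/-- **`b` is not a typed leaf** on a reduced typed graph (rule (d′)): with `b` distinct from the
other marks, a typed edge at `b` forces a second one. -/
theorem Reduced.typedDeg_b {ends : E → Sym2 V} {o a₁ a₂ a₃ b : V} {F : Finset E}
    (h : Reduced ends o a₁ a₂ a₃ b F) (hbo : b ≠ o) (hb1 : b ≠ a₁) (hb2 : b ≠ a₂) (hb3 : b ≠ a₃)
    {f : E} (hf : f ∈ F) (hb : b ∈ ends f) : 2 ≤ typedDeg ends F b := by
  obtain ⟨u, hfu, hbu⟩ := exists_other_end h.no_loop hf hb
  obtain ⟨e', he'F, he'f, hbe'⟩ := h.no_pendant_b f hf u hfu hbu hbo hb1 hb2 hb3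
  exact two_le_typedDeg hf he'F hb hbe' he'f.symm

/-- **`o` is not a typed leaf** on a reduced typed graph (rule (d′)). -/
theorem Reduced.typedDeg_o {ends : E → Sym2 V} {o a₁ a₂ a₃ b : V} {F : Finset E}
    (h : Reduced ends o a₁ a₂ a₃ b F) (ho1 : o ≠ a₁) (ho2 : o ≠ a₂) (ho3 : o ≠ a₃) (hob : o ≠ b)
    {f : E} (hf : f ∈ F) (ho : o ∈ ends f) : 2 ≤ typedDeg ends F o := by
  obtain ⟨u, hfu, hou⟩ := exists_other_end h.no_loop hf ho
  obtain ⟨e', he'F, he'f, hoe'⟩ := h.no_pendant_o f hf u hfu hou ho1 ho2 ho3 hob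
  exact two_le_typedDeg hf he'F ho hoe' he'f.symm

/-- **The marks on `NR`**: `a₁, a₂, o, b` have typed degree `≥ 1`; with the five marks distinct,
`b` and `o` have typed degree `≥ 2`. -/
theorem Residual.typedDeg_marks {ends : E → Sym2 V} {o a₁ a₂ a₃ b : V} {F : Finset E}
    (h : Residual ends o a₁ a₂ a₃ b F) :
    1 ≤ typedDeg ends F a₁ ∧ 1 ≤ typedDeg ends F a₂ ∧ 1 ≤ typedDeg ends F o ∧
      1 ≤ typedDeg ends F b ∧
      (o ≠ a₁ → o ≠ a₂ → o ≠ a₃ → o ≠ b → 2 ≤ typedDeg ends F o) ∧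
      (b ≠ o → b ≠ a₁ → b ≠ a₂ → b ≠ a₃ → 2 ≤ typedDeg ends F b) := by
  obtain ⟨e₁, he₁, h₁⟩ := h.deg_a1
  obtain ⟨e₂, he₂, h₂⟩ := h.deg_a2
  obtain ⟨eo, heo, hoe⟩ := h.deg_o
  obtain ⟨eb, heb, hbe⟩ := h.deg_b
  refine ⟨one_le_typedDeg he₁ h₁, one_le_typedDeg he₂ h₂, one_le_typedDeg heo hoe,
    one_le_typedDeg heb hbe, fun ho1 ho2 ho3 hob => ?_, fun hbo hb1 hb2 hb3 => ?_⟩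
  · exact h.reduced.typedDeg_o ho1 ho2 ho3 hob heo hoe
  · exact h.reduced.typedDeg_b hbo hb1 hb2 hb3 heb hbe

omit [DecidableEq V] [DecidableEq E] in
/-- **A reduced typed graph is simple and has no root edge**: no loop, no parallel pair, no edge
`a₁a₂`. -/
theorem Reduced.simple {ends : E → Sym2 V} {o a₁ a₂ a₃ b : V} {F : Finset E}
    (h : Reduced ends o a₁ a₂ a₃ b F) :
    (∀ f ∈ F, ¬ (ends f).IsDiag) ∧ (∀ e ∈ F, ∀ f ∈ F, e ≠ f → ends e ≠ ends f) ∧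
      ∀ f ∈ F, ends f ≠ s(a₁, a₂) :=
  ⟨h.no_loop, h.no_parallel, h.no_root_pair⟩

end Degree

end TypedRed

end CovForm

end Summit.Ventures.PercRepro2
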